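import Literature.NumberTheory.LFunctions.WeilMarkovThreePrime
import Literature.NumberTheory.LFunctions.KadiriNumericsBase
import HarnessLib

/-!
# rh-explicit (venture WeilGRH): THE CONSTANTS OF THE FRONTIER RUNG `a₀ = 4023/5000`

Cell `rh-explicit`, WEIL TRACK (structure seat weil-3, gen13).  Pure numerics; RH-free.

The tree's unconditionally proved rung is `a₀ = 4023/5000` (`EvenWinsBeyondArch.weilPositivityOn_8046`; visible
prime powers `2, 3, 4`, since `log 2 < a₀ ≤ (log 5)/2`).  The explicit window laws at this rung need five numbers:

(the frontier lies in the `{2,3,4}`-range: `log 2 < a₀ ≤ (log 5)/2`, inlined from Kadiri's enclosures)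
* `two_mul_flatSum_frontier_le`: `2S(a₀) = 2Σ_{n∈{2,3,4}} Λ(n)n^{-1/2}(1 − log n/2a₀) ≤ 1.0566`;
* `primeSum_frontier_le`: `T(a₀) = Σ_{n∈{2,3,4}} Λ(n)n^{-1/2} ≤ 1.4712`;
* `sinh_sq_frontier_le`: `sinh²(a₀/2) ≤ 0.18804`, hence `polarConst_frontier_le`:
  `P(a₀) = (4/a₀)(e^{a₀/2} − e^{−a₀/2})² ≤ 3.74`;
* `expSumConst_frontier_le`: `E(a₀) = e^{−a₀}/(1 − e^{−4a₀}) ≤ 0.54`;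
* `log_sixty_div_two_pi_ge`: `2.25 ≤ log(60/2π)`.

(Kadiri's enclosures of `log 2, 3, 5, π`; `e^x ≥ (1 + x/4)⁴`.)  No definitions, no named facts.
-/

set_option autoImplicit false

noncomputable section

open Real Set Finset
open scoped BigOperators ArithmeticFunction.vonMangoldt

namespace Summit.Ventures.WeilGRH

open Literature.NumberTheory.LFunctions

/-- **`2S(a₀) ≤ 1.0566`**: twice the flat prime sum of the frontier window,
`2[(log 2/√2)(1 − log 2/2a₀) + (log 3/√3)(1 − log 3/2a₀) + ((log 2)/2)(1 − log 4/2a₀)] ≤ 1.0566` (`= 1.05654…`). -/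
theorem two_mul_flatSum_frontier_le :
    2 * (∑ n ∈ weilPrimeIndex (4023 / 5000 : ℝ),
      (Λ n : ℝ) / Real.sqrt n * (1 - Real.log n / (2 * (4023 / 5000 : ℝ)))) ≤ 1.0566 := by
  rw [sum_weilPrimeIndex_eq_threePrime (by have := Real.log_two_lt_d9; linarith)
    (by have := KadiriNumerics.log_5_bounds.1; linarith)]
  push_cast
  have hl2 := Real.log_two_gt_d9
  have hl2' := Real.log_two_lt_d9
  obtain ⟨hl3, hl3'⟩ := KadiriNumerics.log_3_bounds
  have hlog4 : Real.log 4 = 2 * Real.log 2 := by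
    rw [show (4 : ℝ) = 2 ^ 2 by norm_num, Real.log_pow]; norm_num
  have hs2 : (1.41421356 : ℝ) ≤ Real.sqrt 2 := Real.le_sqrt_of_sq_le (by norm_num)
  have hs3 : (1.7320508 : ℝ) ≤ Real.sqrt 3 := Real.le_sqrt_of_sq_le (by norm_num)
  have hs2pos : (0 : ℝ) < Real.sqrt 2 := by linarith
  have hs3pos : (0 : ℝ) < Real.sqrt 3 := by linarith
  rw [hlog4]
  have hA1 : Real.log 2 / Real.sqrt 2 ≤ 0.49013 := by
    rw [div_le_iff₀ hs2pos]; nlinarith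
  have hA1' : 0 ≤ Real.log 2 / Real.sqrt 2 := div_nonneg (by linarith) hs2pos.le
  have hB1 : 1 - Real.log 2 / (2 * (4023 / 5000 : ℝ)) ≤ 0.56926 := by
    have key : (0.43074 : ℝ) ≤ Real.log 2 / (2 * (4023 / 5000)) := by
      rw [le_div_iff₀ (by norm_num)]; norm_num; linarith
    linarith
  have hB1' : 0 ≤ 1 - Real.log 2 / (2 * (4023 / 5000 : ℝ)) := by
    rw [sub_nonneg, div_le_one (by norm_num)]; linarith
  have hA2 : Real.log 3 / Real.sqrt 3 ≤ 0.634285 := by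
    rw [div_le_iff₀ hs3pos]; nlinarith
  have hA2' : 0 ≤ Real.log 3 / Real.sqrt 3 := div_nonneg (by linarith) hs3pos.le
  have hB2 : 1 - Real.log 3 / (2 * (4023 / 5000 : ℝ)) ≤ 0.317293 := by
    have key : (0.682707 : ℝ) ≤ Real.log 3 / (2 * (4023 / 5000)) := by
      rw [le_div_iff₀ (by norm_num)]; norm_num; linarith
    linarith
  have hB2' : 0 ≤ 1 - Real.log 3 / (2 * (4023 / 5000 : ℝ)) := by
    rw [sub_nonneg, div_le_one (by norm_num)]; linarith
  have hA3 : Real.log 2 / 2 ≤ 0.3465736 := by linarith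
  have hA3' : 0 ≤ Real.log 2 / 2 := by linarith
  have hB3 : 1 - 2 * Real.log 2 / (2 * (4023 / 5000 : ℝ)) ≤ 0.13852 := by
    have key : (0.86148 : ℝ) ≤ 2 * Real.log 2 / (2 * (4023 / 5000)) := by
      rw [le_div_iff₀ (by norm_num)]; norm_num; linarith
    linarith
  have hB3' : 0 ≤ 1 - 2 * Real.log 2 / (2 * (4023 / 5000 : ℝ)) := by
    rw [sub_nonneg, div_le_one (by norm_num)]; linarith
  have h1 := mul_le_mul hA1 hB1 hB1' (by norm_num)
  have h2 := mul_le_mul hA2 hB2 hB2' (by norm_num)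
  have h3 := mul_le_mul hA3 hB3 hB3' (by norm_num)
  norm_num at h1 h2 h3 ⊢
  linarith

/-- **`T(a₀) ≤ 1.4712`**: the plain prime sum `log 2/√2 + log 3/√3 + (log 2)/2` of the frontier window (`= 1.47099…`). -/
theorem primeSum_frontier_le :
    ∑ n ∈ weilPrimeIndex (4023 / 5000 : ℝ), (Λ n : ℝ) / Real.sqrt n ≤ 1.4712 := by
  have h := sum_weilPrimeIndex_eq_threePrime (b := (4023 / 5000 : ℝ)) (by have := Real.log_two_lt_d9; linarith)
    (by have := KadiriNumerics.log_5_bounds.1; linarith) (fun _ ↦ (1 : ℝ))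
  simp only [mul_one] at h
  rw [h]
  have hl2' := Real.log_two_lt_d9
  have hl2 := Real.log_two_gt_d9
  obtain ⟨hl3, hl3'⟩ := KadiriNumerics.log_3_bounds
  have hs2 : (1.41421356 : ℝ) ≤ Real.sqrt 2 := Real.le_sqrt_of_sq_le (by norm_num)
  have hs3 : (1.7320508 : ℝ) ≤ Real.sqrt 3 := Real.le_sqrt_of_sq_le (by norm_num)
  have hs2pos : (0 : ℝ) < Real.sqrt 2 := by linarith
  have hs3pos : (0 : ℝ) < Real.sqrt 3 := by linarith
  have hA1 : Real.log 2 / Real.sqrt 2 ≤ 0.49013 := by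
    rw [div_le_iff₀ hs2pos]; nlinarith
  have hA2 : Real.log 3 / Real.sqrt 3 ≤ 0.634285 := by
    rw [div_le_iff₀ hs3pos]; nlinarith
  have hA3 : Real.log 2 / 2 ≤ 0.3465736 := by linarith
  linarith

/-- `sinh²(a₀/2) ≤ 0.18804` (`a₀/2 = 0.4023`; `cosh x ≤ e^{x²/2}`, `e^{s} ≤ 1 + s + s²` for `s = x² ≤ 1`). -/
theorem sinh_sq_frontier_le : Real.sinh (4023 / 5000 / 2) ^ 2 ≤ 0.18804 := by
  set x : ℝ := 4023 / 5000 / 2 with hx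
  have hc := Real.cosh_sq x
  have h1 := Real.cosh_le_exp_half_sq x
  have h0 : 0 ≤ Real.cosh x := (Real.cosh_pos x).le
  have h2 : Real.cosh x ^ 2 ≤ Real.exp (x ^ 2) := by
    calc Real.cosh x ^ 2 ≤ Real.exp (x ^ 2 / 2) ^ 2 := pow_le_pow_left₀ h0 h1 2
      _ = Real.exp (x ^ 2) := by rw [sq, ← Real.exp_add]; ring_nf
  have hs : |x ^ 2| ≤ 1 := by rw [hx]; norm_num
  have h3 := Real.abs_exp_sub_one_sub_id_le hs
  have h4 := (abs_le.1 h3).2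
  have hx2 : x ^ 2 = 0.16184529 := by rw [hx]; norm_num
  calc Real.sinh x ^ 2 = Real.cosh x ^ 2 - 1 := by linarith
    _ ≤ Real.exp (x ^ 2) - 1 := by linarith
    _ ≤ x ^ 2 + (x ^ 2) ^ 2 := by linarith
    _ = 0.16184529 + 0.16184529 ^ 2 := by rw [hx2]
    _ ≤ 0.18804 := by norm_num

/-- **`P(a₀) = (4/a₀)(e^{a₀/2} − e^{−a₀/2})² ≤ 3.74`** (`= (16/a₀) sinh²(a₀/2)`). -/
theorem polarConst_frontier_le :
    (4 / (4023 / 5000 : ℝ)) * (Real.exp ((4023 / 5000 : ℝ) / 2) - Real.exp (-((4023 / 5000 : ℝ) / 2))) ^ 2 ≤ 3.74 := by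
  have hs := sinh_sq_frontier_le
  have he : Real.exp ((4023 / 5000 : ℝ) / 2) - Real.exp (-((4023 / 5000 : ℝ) / 2)) = 2 * Real.sinh (4023 / 5000 / 2) := by
    rw [Real.sinh_eq]; ring
  rw [he, mul_pow]
  norm_num at hs ⊢
  nlinarith

/-- `e^{−x} ≤ 1/(1 + x/4)⁴` for `x ≥ 0` (`e^{x/4} ≥ 1 + x/4`). -/
theorem exp_neg_le_inv_quartic {x : ℝ} (hx : 0 ≤ x) : Real.exp (-x) ≤ 1 / (1 + x / 4) ^ 4 := by
  have h1 : 1 + x / 4 ≤ Real.exp (x / 4) := by have := Real.add_one_le_exp (x / 4); linarith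
  have h0 : 0 < 1 + x / 4 := by linarith
  have h4 : (1 + x / 4) ^ 4 ≤ Real.exp x := by
    calc (1 + x / 4) ^ 4 ≤ Real.exp (x / 4) ^ 4 := pow_le_pow_left₀ h0.le h1 4
      _ = Real.exp x := by rw [← Real.exp_nat_mul]; ring_nf
  rw [Real.exp_neg, le_div_iff₀ (by positivity)]
  calc (Real.exp x)⁻¹ * (1 + x / 4) ^ 4 ≤ (Real.exp x)⁻¹ * Real.exp x :=
        mul_le_mul_of_nonneg_left h4 (inv_nonneg.2 (Real.exp_pos x).le)
    _ = 1 := inv_mul_cancel₀ (Real.exp_pos x).ne'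

/-- **`E(a₀) = e^{−a₀}/(1 − e^{−4a₀}) ≤ 0.54`**. -/
theorem expSumConst_frontier_le :
    Real.exp (-(4023 / 5000 : ℝ)) / (1 - Real.exp (-(4 * (4023 / 5000 : ℝ)))) ≤ 0.54 := by
  have h1 := exp_neg_le_inv_quartic (show (0 : ℝ) ≤ 4023 / 5000 by norm_num)
  have h2 := exp_neg_le_inv_quartic (show (0 : ℝ) ≤ 4 * (4023 / 5000) by norm_num)
  have h1' : Real.exp (-(4023 / 5000 : ℝ)) ≤ 0.4805 := h1.trans (by norm_num)
  have h2' : Real.exp (-(4 * (4023 / 5000 : ℝ))) ≤ 0.0943 := h2.trans (by norm_num)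
  have hpos : 0 < Real.exp (-(4023 / 5000 : ℝ)) := Real.exp_pos _
  have hden : 0.9057 ≤ 1 - Real.exp (-(4 * (4023 / 5000 : ℝ))) := by linarith
  rw [div_le_iff₀ (by linarith)]
  nlinarith

/-- **`2.25 ≤ log(60/2π)`** (`log(30/π) = log 2 + log 3 + log 5 − log π = 2.2564…`). -/
theorem log_sixty_div_two_pi_ge : (2.25 : ℝ) ≤ Real.log (60 / (2 * π)) := by
  have hl2 := Real.log_two_gt_d9
  obtain ⟨hl3, -⟩ := KadiriNumerics.log_3_bounds
  obtain ⟨hl5, -⟩ := KadiriNumerics.log_5_bounds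
  obtain ⟨-, hlpi⟩ := KadiriNumerics.log_pi_bounds
  have h : Real.log (60 / (2 * π)) = Real.log 2 + Real.log 3 + Real.log 5 - Real.log π := by
    rw [show (60 : ℝ) / (2 * π) = 2 * 3 * 5 / π by ring, Real.log_div (by norm_num) Real.pi_pos.ne',
      Real.log_mul (by norm_num) (by norm_num), Real.log_mul (by norm_num) (by norm_num)]
  rw [h]
  linarith

/-- `cosh²(a₀/2) ≤ 1.18804` at the frontier rung `a₀ = 4023/5000` (`cosh² = sinh² + 1` and `sinh_sq_frontier_le`); the pole
constant of the Beurling–Selberg window files (appended 2026-08-24, weil-3 gen14, so that the window files share ONE copy). -/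
theorem cosh_sq_frontier_le : Real.cosh ((4023 / 5000 : ℝ) / 2) ^ 2 ≤ 1.18804 := by
  have h := sinh_sq_frontier_le
  rw [Real.cosh_sq]
  norm_num at h ⊢; linarith

end Summit.Ventures.WeilGRH

end
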